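import Literature.NumberTheory.EllipticCurves.BigGaloisRepSelmer
import HarnessLib

/-!
# Crux 4 `BSDpOnCellC` (stmt-BirchSwinnertonDyer-19034), line «telescope» v10, leaf N2|pub sub-leaf W2 / leaf N3′ — the (ann) input, second brick:
# `A^{Γ}/c·A^{Γ} ↪ H¹(Γ, A[c])` (connecting homomorphism of `0 → A[c] → A →(c) A → 0`), hence
# `(A^{Γ}/c·A^{Γ})^∨` is finitely generated as soon as `H¹(Γ, A[c])^∨` is
# (successor LEAD `cruxlead-19034` g3; `--supports`, helper; THEOREMS ONLY; generic; closes no registered stub)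

HONEST FRAMING. No registered stub, no crux, no summit statement is proved; BSD is proved for no curve. With
`TelescopeK2FrobeniusAnnihilator.frobeniusAnnihilator_of_finite` (p755236) the (ann) input of W2 (x2-p2 g19, p752662) at `(w, d)` follows from
«the Pontryagin dual of `A₂^{I_w}/X·A₂^{I_w}` is finitely generated»; this file reduces that, for ANY discrete representation `ρ : Γ → Aut_S(A)`
and any `c ∈ S` acting SURJECTIVELY on `A` (N1's (div₀) for `c = X`), to «the Pontryagin dual of `H¹(Γ, A[c])` is finitely generated», by the
connecting homomorphism `δ₀ : A^Γ → H¹(Γ, A[c])` of the short exact sequence `0 → A[c] → A →(c) A → 0`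
(tree: `IsSES.δ₀`, `IsSES.δ₀_eq_zero_iff`),
whose kernel is exactly `c·A^Γ`. What then remains for (ann), by name: `Module.Finite ℤ_p⟦X⟧ (CharacterModule (H¹(I_w, A₂[X])))` at `w ∤ p`
(classical: `A₂[X] ≈ E[p^∞]` by (fd₀), `H¹(I_w, ·)` of a cofinitely generated `ℤ_p`-module at `w ∤ p` is cofinitely generated — tree tools:
`natCard_continuousCohomology_one_absInertia_le` (finite coefficients), `finite_torsionBy_continuousCohomology_one_absInertia` (divisible
coefficients), `SkinnerUrban2014.module_finite_characterModule_of_torsion_finite`).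

* **`exists_linearMap_invariants_ker_eq`** — `∃ δ : A^Γ →ₗ[S] H¹(Γ, A[c])` with `δ v = 0 ↔ ∃ w ∈ A^Γ, c • w = v`.
* **`finite_characterModule_invariantsQuot_of_h1`** — `Module.Finite S (H¹(Γ, A[c])^∨) → Module.Finite S ((A^Γ ⧸ c·A^Γ)^∨)`.
* **`invariants_restrict_eq`** — for `ρ : Γ_K → Aut_S(A)` and a finite place `w`, the invariants of `ρ.restrict (localMap K (Sum.inr w))` are the
  submodule `⨅ h, eqLocus (ρ (localMap K (Sum.inr w) h)) id` of p755236 (bridging the two spellings of `A^{I_w}`).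

References: J.-P. Serre, Cohomologie galoisienne, I §2.2 [SerreGaloisCohomology1997]; Jetchev–Skinner–Wan, Camb. J. Math. 5 (2017) §3.4
[JetchevSkinnerWan2017]; R. Greenberg, LNM 1716 (1999) §4 [Greenberg1999LNM].
-/

set_option autoImplicit false
set_option linter.dupNamespace false

noncomputable section

universe u

open Field IsDedekindDomain NumberField
open Literature.NumberTheory.GaloisRepresentations Literature.NumberTheory.EllipticCurves
  Literature.NumberTheory.EllipticCurves.BigGaloisRep

namespace Summit.BirchSwinnertonDyer.BirchSwinnertonDyer.Theorems.TelescopeK2InvariantsQuotToH1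

section General

variable {S : Type*} [CommRing S] [TopologicalSpace S]
  {Γ : Type u} [Group Γ] [TopologicalSpace Γ] [IsTopologicalGroup Γ]
  {A : Type u} [AddCommGroup A] [Module S A] [TopologicalSpace A] [DiscreteTopology A] [ContinuousSMul S A]

/-- **The connecting map `δ₀ : A^Γ → H¹(Γ, A[c])` of `0 → A[c] → A →(c) A → 0` and its kernel.** For a discrete continuous representation
`ρ : Γ → Aut_S(A)` and `c ∈ S` with `c • _` SURJECTIVE on `A`, there is an `S`-linear `δ : A^Γ → H¹(Γ, A[c])` (invariants of `ρ.toTopRep`,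
cohomology of `torsionRep ρ c`) with `δ v = 0 ↔ v ∈ c·A^Γ`. [cite: SerreGaloisCohomology1997, I §2.2] -/
theorem exists_linearMap_invariants_ker_eq (ρ : ContinuousRep Γ S A) (c : S) (hdiv : ∀ a : A, ∃ b : A, c • b = a) :
    ∃ δ : ρ.toTopRep.ρ.invariants →ₗ[S] continuousCohomology 1 (torsionRep ρ c).toTopRep,
      ∀ v : ρ.toTopRep.ρ.invariants, δ v = 0 ↔ ∃ w : A, w ∈ ρ.toTopRep.ρ.invariants ∧ c • w = (v : A) := by
  -- multiplication by the central scalar `c` as an endomorphism of `ρ.toTopRep`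
  let g : ρ.toTopRep ⟶ ρ.toTopRep :=
    TopRep.ofHom
      { toLinearMap :=
          { toFun := fun a => c • a
            map_add' := fun a b => smul_add c a b
            map_smul' := fun s a => smul_comm c s a }
        cont := continuous_of_discreteTopology
        isIntertwining' := fun σ => by
          refine ContinuousLinearMap.ext fun a => ?_
          change c • ρ.toTopRep.ρ σ a = ρ σ (c • a)
          rw [ContinuousRep.toTopRep_ρ_apply, map_smul] }
  have hg : ∀ a : A, g.hom a = c • a := fun _ => rfl
  have hSES : IsSES (torsionIncl ρ c) g :=
    { comp_eq_zero := by
        ext a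
        change c • ((a : Submodule.torsionBy S A c) : A) = 0
        exact (Submodule.mem_torsionBy_iff c (a : A)).1 a.2
      injective := Subtype.val_injective
      exact_mid := fun y hy => ⟨⟨y, (Submodule.mem_torsionBy_iff c y).2 hy⟩, rfl⟩
      surjective := fun a => hdiv a }
  refine ⟨hSES.δ₀, fun v => ?_⟩
  rw [hSES.δ₀_eq_zero_iff]
  exact ⟨fun ⟨w, hw, hwv⟩ => ⟨w, hw, hwv⟩, fun ⟨w, hw, hwv⟩ => ⟨w, hw, hwv⟩⟩

/-- **`(A^Γ/c·A^Γ)^∨` is finitely generated if `H¹(Γ, A[c])^∨` is** (`c` surjective on `A`): the connecting map embeds `A^Γ/c·A^Γ` into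
`H¹(Γ, A[c])`, and Pontryagin duality turns the embedding into a surjection of duals. [cite: SerreGaloisCohomology1997, I §2.2]
[cite: Greenberg1999LNM, §4] -/
theorem finite_characterModule_invariantsQuot_of_h1 (ρ : ContinuousRep Γ S A) (c : S) (hdiv : ∀ a : A, ∃ b : A, c • b = a)
    (hfin : Module.Finite S (CharacterModule (continuousCohomology 1 (torsionRep ρ c).toTopRep))) :
    Module.Finite S (CharacterModule (↥ρ.toTopRep.ρ.invariants ⧸
      LinearMap.range (LinearMap.lsmul S ↥ρ.toTopRep.ρ.invariants c))) := by
  haveI := hfin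
  obtain ⟨δ, hδ⟩ := exists_linearMap_invariants_ker_eq ρ c hdiv
  set N : Submodule S ↥ρ.toTopRep.ρ.invariants := LinearMap.range (LinearMap.lsmul S ↥ρ.toTopRep.ρ.invariants c) with hN
  have hker : LinearMap.ker δ = N := by
    ext v
    rw [LinearMap.mem_ker, hδ, hN, LinearMap.mem_range]
    constructor
    · rintro ⟨w, hw, hwv⟩
      exact ⟨⟨w, hw⟩, Subtype.ext (by rw [LinearMap.lsmul_apply, Submodule.coe_smul, hwv])⟩
    · rintro ⟨w, hwv⟩
      refine ⟨(w : A), w.2, ?_⟩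
      rw [← hwv, LinearMap.lsmul_apply, Submodule.coe_smul]
  let ι : (↥ρ.toTopRep.ρ.invariants ⧸ N) →ₗ[S] continuousCohomology 1 (torsionRep ρ c).toTopRep :=
    N.liftQ δ (by rw [hker])
  have hι : Function.Injective ι := by
    rw [← LinearMap.ker_eq_bot]
    exact Submodule.ker_liftQ_eq_bot' N δ hker.symm
  exact Module.Finite.of_surjective (CharacterModule.dual ι) (CharacterModule.dual_surjective_of_injective ι hι)

end General

/-- **Bridging the two spellings of `A^{I_w}`.** For `ρ : Γ_K → Aut_S(A)` and a finite place `w` of `K`, the invariants of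
`ρ.restrict (localMap K (Sum.inr w))` (the inertia representation) are the submodule `⨅ h, eqLocus (ρ (localMap K (Sum.inr w) h)) id`
of `TelescopeK2FrobeniusAnnihilator.frobeniusAnnihilator_of_finite`. [folklore] -/
theorem invariants_restrict_eq {K : Type} [Field K] [NumberField K]
    {S : Type*} [CommRing S] [TopologicalSpace S] {A : Type} [AddCommGroup A] [Module S A] [TopologicalSpace A]
    [DiscreteTopology A] [ContinuousSMul S A]
    (ρ : ContinuousRep (absoluteGaloisGroup K) S A) (w : HeightOneSpectrum (𝓞 K)) :
    (ρ.restrict (localMap K (Sum.inr w))).toTopRep.ρ.invariants =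
      ⨅ h : LocalGroup K (Sum.inr w), LinearMap.eqLocus (ρ (localMap K (Sum.inr w) h)) LinearMap.id := by
  ext a
  simp only [Submodule.mem_iInf, LinearMap.mem_eqLocus, LinearMap.id_apply]
  exact ⟨fun ha h => ha h, fun ha h => ha h⟩

end Summit.BirchSwinnertonDyer.BirchSwinnertonDyer.Theorems.TelescopeK2InvariantsQuotToH1

end
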